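import Literature.AlgebraicGeometry.Motives.HodgeStructureLefschetzGroupInternalBlocksPoints
import Literature.AlgebraicGeometry.Motives.HodgeStructureCentralizerFiniteDirectSumPoints
import Literature.AlgebraicGeometry.Motives.HodgeStructureCentralizerTransportPoints
import HarnessLib

/-!
# MILNE'S PROP. 1.1 ON `K`-POINTS, INTERNALLY («`C'(A) ≅ C(A) ⊗_k k'`», Remark 1.6): for every field `K ⊇ ℚ`,
# `C(H)(K) ≃ₐ[K] Π_k C(W_k)(K)` along a Hom-orthogonal internal direct sum of sub-Hodge structures and over the canonical blocks,
# `C(⊕ᵢ Tᵢ ≅ H₀)(K) ≃ₐ[K] C(H₀)(K)`, `C(H)(K) ≃ₐ[K] Π_k C(T_k)(K)` over the representatives of the isotypy classes, `C(S)(K) ≃ₐ[K]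
# C(U)(K)` for a canonical block, and `C(H₁)(K) ≃ₐ[K] C(H₂)(K)` along a Hodge isomorphism (Milne 1999 §1 Prop. 1.1, Remark 1.6)

[topic AlgebraicGeometry/Motives]

Layer `Literature/AlgebraicGeometry/Motives`, lane `lit-hodgefound` (Track 2 foundations library; prover seat
`lit-hodgefound-p02`, generation 52, self-proposed row g52-#10). THEOREMS ONLY: no definition, no named fact (net debt `0`),
no instance, no notation.  The `K`-points companion of g52-#3 ∕ #5 (`C(H) ≃ₐ Π_k C(W_k)`, `C(H) ≃ₐ Π_k C(T_k)` for `k = ℚ`) and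
the `C`-analogue of g52-#9 (`S(H)(K)`): Milne's `C(A) ⊗_k K` is p34's `Subalgebra.centralizer K (E_φ ⊗ K)` — the centralizer in
`End_K(K ⊗ V)` of the base-changed Hodge endomorphisms.  Joins BY NAME (nothing restated): p34's `K`-points transport
`centralizerEndAlgBaseChangeComapEquivAlgEquiv : C(e^* H)(K) ≃ₐ[K] C(H)(K)` (`Motives/HodgeStructureCentralizerTransportPoints`),
EXTERNAL Prop. 1.1 on `K`-points `centralizerBaseChangePiAlgEquiv : C(⊕_j H_j)(K) ≃ₐ[K] Π_j C(H_j)(K)` and diagonal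
`centralizerBaseChangePiConstAlgEquiv : C(H₀)(K) ≃ₐ[K] C(H₀^{⊕ι})(K)` (`Motives/HodgeStructureCentralizerFiniteDirectSumPoints`),
g52-#5 ∕ #9 (`eq_comapEquiv_of_hom_bijective`, `bijective_piDesc_subtypeHom_comp_toLinearMap`, `bijective_piDesc_subtypeHom_toLinearMap`),
the isotypic blocks (`isInternal_iSup'_fiber`, `hom_iSup'_fiber_eq_zero`, `isInternal_comapSubtype_iSup'_fiber`,
`exists_hom_comapSubtype_bijective`), g51's canonical blocks (`Polarization.isInternal_minimal_stable`,
`Polarization.hom_eq_zero_of_minimal_stable_of_ne`) and g52-#1 (`existsUnique_iSup'_fiber_eq_of_minimal_stable`,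
`exists_hom_bijective_iff_eq_of_minimal_stable`).

## The source, verbatim

J. S. Milne, *Lefschetz classes on abelian varieties*, Duke Math. J. 96 (1999) 639–675 [Milne1999LefschetzClasses] (held
`paper:doi-10-1215-s0012-7094-99-09620-5`), §1 p. 643 L7–L14: "An isogeny `α : A → B` defines an isomorphism `γ ↦ V(α) ∘ γ ∘
V(α)⁻¹ : C(A) → C(B)` […]. For any positive integer `r`, `V(A^r) = rV(A)`, and the diagonal action of `C(A)` on `rV(A)` identifies
`C(A)` with `C(A^r)`"; L24–L28: "**Proposition 1.1.** Let `A₁, …, A_s` be a set of representatives for the simple isogeny factors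
of `A` […]. Any such isogeny induces an isomorphism `C(A₁) × ⋯ × C(A_s) → C(A)` of `k`-algebras with involution, which is
independent of the choice of the isogeny."; p. 644 L30–L34: "**Remark 1.6.** […] If `C'(A)` and `S'(A)` denote the objects
defined relative to the second theory, then there are canonical isomorphisms `C'(A) ≅ C(A) ⊗_k k'`, `S'(A) ≅ S(A)_{/k'}`."

## Dictionary and what is proved (namespace `Literature.AlgebraicGeometry.Motives.HodgeStructure`)

`C(H)(K) = Subalgebra.centralizer K ((· ⊗ K) '' E_φ(H)) ⊆ End_K(K ⊗_ℚ V)`; `⊕_k W_k = HodgeStructure.pi (fun k ↦ (W k).toHodgeStructure)`.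
p34's external lemmas have small index types (`ι : Type`); arbitrary finite index types are reached by re-indexing along
`Fintype.equivFin` (`AlgEquiv.piCongrLeft'`).

* §1 **`exists_centralizer_baseChange_algEquiv_of_hom_bijective`** (a Hodge isomorphism `g : H₁ ⥲ H₂` induces `C(H₁)(K) ≃ₐ[K]
  C(H₂)(K)`, `c ↦ g_K c g_K⁻¹`).
* §2 **`nonempty_centralizer_baseChange_algEquiv_pi_of_hom_orthogonal`** (PROP. 1.1 on `K`-points along a Hom-orthogonal internal
  direct sum: `C(H)(K) ≃ₐ[K] Π_k C(W_k)(K)`), `…_of_forall_stable`, **`Polarization.nonempty_centralizer_baseChange_algEquiv_pi_minimal_stable`**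
  (over the canonical blocks).
* §3 **`nonempty_centralizer_baseChange_algEquiv_of_isInternal_of_forall_bijective`** (`C(⊕ᵢ Tᵢ ≅ H₀)(K) ≃ₐ[K] C(H₀)(K)`),
  `nonempty_centralizer_baseChange_iSup'_fiber_algEquiv` (`C(W_k)(K) ≃ₐ[K] C(T_k)(K)` per isotypic block),
  **`nonempty_centralizer_baseChange_algEquiv_pi_of_labelling`** (PROP. 1.1 on `K`-points over the representatives),
  **`nonempty_centralizer_baseChange_algEquiv_of_minimal_stable`**
  (`C(S)(K) ≃ₐ[K] C(U)(K)` for a canonical block).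
-/

noncomputable section

open scoped TensorProduct

namespace Literature.AlgebraicGeometry.Motives

namespace HodgeStructure

universe u uK

variable (K : Type uK) [Field K] [Algebra ℚ K] {n : ℤ}

/-- Re-indexing an internal direct sum along an equivalence of index types. [folklore] -/
private theorem isInternal_comp_equiv''' {V' : Type u} [AddCommGroup V'] [Module ℚ V'] {ι ι' : Type*} [DecidableEq ι]
    [DecidableEq ι'] {A : ι → Submodule ℚ V'} (hA : DirectSum.IsInternal A) (e : ι' ≃ ι) :
    DirectSum.IsInternal fun j => A (e j) := by
  refine (DirectSum.isInternal_submodule_iff_iSupIndep_and_iSup_eq_top _).2 ⟨?_, ?_⟩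
  · exact hA.submodule_iSupIndep.comp e.injective
  · rw [e.iSup_comp (g := A)]
    exact hA.submodule_iSup_eq_top

/-! ## §1 Transport of `C(K)` along a Hodge isomorphism -/

section Transport

variable {V W : Type u} [AddCommGroup V] [Module ℚ V] [AddCommGroup W] [Module ℚ W]
  {H₁ : HodgeStructure V n} {H₂ : HodgeStructure W n}

/-- **«`γ ↦ V(α) ∘ γ ∘ V(α)⁻¹ : C(A) → C(B)`» on `K`-points**: a bijective morphism of Hodge structures `g : H₁ ⥲ H₂` induces an
isomorphism of `K`-algebras `C(H₁)(K) ≃ₐ[K] C(H₂)(K)` lying over `g_K = g ⊗ K`, `(e c) (g_K x) = g_K (c x)` (`H₁ = g^* H₂`, g52-#5,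
and p34's `K`-points transport). [cite: Milne1999LefschetzClasses, §1 p. 643 L7–L8 and Remark 1.6 (p. 644)]
[cite: VoisinHodgeI2002, §7.3.1 Lemma 7.23] -/
theorem exists_centralizer_baseChange_algEquiv_of_hom_bijective (g : Hom H₁ H₂) (hg : Function.Bijective g.toLinearMap) :
    ∃ e : Subalgebra.centralizer K ((fun a : Module.End ℚ V => a.baseChange K) '' (H₁.endAlg : Set (Module.End ℚ V))) ≃ₐ[K]
        Subalgebra.centralizer K ((fun b : Module.End ℚ W => b.baseChange K) '' (H₂.endAlg : Set (Module.End ℚ W))),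
      ∀ (c : Subalgebra.centralizer K ((fun a : Module.End ℚ V => a.baseChange K) '' (H₁.endAlg : Set (Module.End ℚ V))))
        (x : K ⊗[ℚ] V),
        ((e c : Subalgebra.centralizer K ((fun b : Module.End ℚ W => b.baseChange K) '' (H₂.endAlg : Set (Module.End ℚ W)))) :
            Module.End K (K ⊗[ℚ] W)) (g.toLinearMap.baseChange K x) =
          g.toLinearMap.baseChange K ((c : Module.End K (K ⊗[ℚ] V)) x) := by
  have h := eq_comapEquiv_of_hom_bijective g hg
  have hC : Subalgebra.centralizer K ((fun a : Module.End ℚ V => a.baseChange K) '' (H₁.endAlg : Set (Module.End ℚ V))) =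
      Subalgebra.centralizer K ((fun a : Module.End ℚ V => a.baseChange K) ''
        ((H₂.comapEquiv (LinearEquiv.ofBijective g.toLinearMap hg)).endAlg : Set (Module.End ℚ V))) := by
    rw [← h]
  refine ⟨(Subalgebra.equivOfEq _ _ hC).trans
    (centralizerEndAlgBaseChangeComapEquivAlgEquiv K H₂ (LinearEquiv.ofBijective g.toLinearMap hg)), fun c x => ?_⟩
  have hx : g.toLinearMap.baseChange K x = (LinearEquiv.ofBijective g.toLinearMap hg).baseChange ℚ K V W x := rfl
  rw [AlgEquiv.trans_apply, centralizerEndAlgBaseChangeComapEquivAlgEquiv_apply_apply, hx, LinearEquiv.symm_apply_apply]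
  rfl

end Transport

/-! ## §2 Prop. 1.1 on `K`-points along a Hom-orthogonal internal direct sum, and over the canonical blocks -/

section Blocks

variable {V : Type u} [AddCommGroup V] [Module ℚ V] [Module.Finite ℚ V] {H : HodgeStructure V n}

/-- Prop. 1.1 on `K`-points for a Hom-orthogonal internal direct sum with a SMALL index type (`κ : Type`): transport along
`⊕_k W_k ⥲ H` (g52-#9 §1), then p34's external `C(⊕_k W_k)(K) ≃ₐ[K] Π_k C(W_k)(K)`.
[cite: Milne1999LefschetzClasses, §1 Prop. 1.1 (p. 643) and Remark 1.6 (p. 644)] -/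
theorem nonempty_centralizer_baseChange_algEquiv_pi_of_hom_orthogonal_small {κ : Type} [Fintype κ] [DecidableEq κ]
    (W : κ → SubHodgeStructure H) (hW : DirectSum.IsInternal fun k => (W k).toSubmodule)
    (horth : ∀ k l, k ≠ l → ∀ f : Hom (W k).toHodgeStructure (W l).toHodgeStructure, f = 0) :
    Nonempty (Subalgebra.centralizer K ((fun a : Module.End ℚ V => a.baseChange K) '' (H.endAlg : Set (Module.End ℚ V))) ≃ₐ[K]
      Π k, Subalgebra.centralizer K ((fun a : Module.End ℚ (W k).toSubmodule => a.baseChange K) ''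
        ((W k).toHodgeStructure.endAlg : Set (Module.End ℚ (W k).toSubmodule)))) := by
  obtain ⟨e, -⟩ := exists_centralizer_baseChange_algEquiv_of_hom_bijective K _ (bijective_piDesc_subtypeHom_toLinearMap W hW)
  have h0 : ∀ i j, i ≠ j → ∀ φ : Hom (W j).toHodgeStructure (W i).toHodgeStructure, φ.toLinearMap = 0 :=
    fun i j hij φ => by rw [horth j i (Ne.symm hij) φ, Hom.zero_toLinearMap]
  exact ⟨e.symm.trans (centralizerBaseChangePiAlgEquiv K (W := fun k => ↥(W k).toSubmodule)
    (H := fun k => (W k).toHodgeStructure) h0)⟩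

/-- **MILNE'S PROP. 1.1 ON `K`-POINTS, INTERNALLY: `C(H)(K) ≃ₐ[K] Π_k C(W_k)(K)`** for every field `K ⊇ ℚ` and every Hom-orthogonal
internal direct sum `V = ⊕_k W_k` of sub-Hodge structures («an isomorphism `C(A₁) × ⋯ × C(A_s) → C(A)` of `k`-algebras», read on
`K`-points: `C'(A) ≅ C(A) ⊗_k k'`). [cite: Milne1999LefschetzClasses, §1 Prop. 1.1 (p. 643) and Remark 1.6 (p. 644)]
[cite: Moonen2004MT, §4 Lemma 4.6] -/
theorem nonempty_centralizer_baseChange_algEquiv_pi_of_hom_orthogonal {κ : Type*} [Fintype κ] [DecidableEq κ]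
    (W : κ → SubHodgeStructure H) (hW : DirectSum.IsInternal fun k => (W k).toSubmodule)
    (horth : ∀ k l, k ≠ l → ∀ f : Hom (W k).toHodgeStructure (W l).toHodgeStructure, f = 0) :
    Nonempty (Subalgebra.centralizer K ((fun a : Module.End ℚ V => a.baseChange K) '' (H.endAlg : Set (Module.End ℚ V))) ≃ₐ[K]
      Π k, Subalgebra.centralizer K ((fun a : Module.End ℚ (W k).toSubmodule => a.baseChange K) ''
        ((W k).toHodgeStructure.endAlg : Set (Module.End ℚ (W k).toSubmodule)))) := by
  let eκ := Fintype.equivFin κ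
  obtain ⟨e⟩ := nonempty_centralizer_baseChange_algEquiv_pi_of_hom_orthogonal_small K (fun j => W (eκ.symm j))
    (isInternal_comp_equiv''' hW eκ.symm) fun j j' hjj' f => horth _ _ (fun h => hjj' (eκ.symm.injective h)) f
  exact ⟨e.trans (AlgEquiv.piCongrLeft' (R := K) (A₁ := fun k => ↥(Subalgebra.centralizer K
    ((fun a : Module.End ℚ (W k).toSubmodule => a.baseChange K) ''
      ((W k).toHodgeStructure.endAlg : Set (Module.End ℚ (W k).toSubmodule))))) eκ).symm⟩

/-- **`C(H)(K) ≃ₐ[K] Π_k C(W_k)(K)` along an internal direct sum into `E_φ`-STABLE sub-Hodge structures.**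
[cite: Milne1999LefschetzClasses, §1 Prop. 1.1 (p. 643) and Remark 1.6 (p. 644)] -/
theorem nonempty_centralizer_baseChange_algEquiv_pi_of_forall_stable {κ : Type*} [Fintype κ] [DecidableEq κ]
    (W : κ → SubHodgeStructure H) (hW : DirectSum.IsInternal fun k => (W k).toSubmodule)
    (hst : ∀ k, ∀ a ∈ H.endAlg, ∀ v ∈ (W k).toSubmodule, a v ∈ (W k).toSubmodule) :
    Nonempty (Subalgebra.centralizer K ((fun a : Module.End ℚ V => a.baseChange K) '' (H.endAlg : Set (Module.End ℚ V))) ≃ₐ[K]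
      Π k, Subalgebra.centralizer K ((fun a : Module.End ℚ (W k).toSubmodule => a.baseChange K) ''
        ((W k).toHodgeStructure.endAlg : Set (Module.End ℚ (W k).toSubmodule)))) :=
  nonempty_centralizer_baseChange_algEquiv_pi_of_hom_orthogonal K W hW fun _ _ hkl f =>
    hom_eq_zero_of_forall_stable W hW hst hkl f

open Classical in
/-- **`C(H)(K) ≃ₐ[K] Π_i C(S_i)(K)` over the CANONICAL blocks** (the minimal `E_φ`-stable sub-Hodge structures of a polarized `H`).
[cite: Milne1999LefschetzClasses, §1 Prop. 1.1 (p. 643) and Remark 1.6 (p. 644)] [cite: Lange2023AbelianVarietiesComplex, §2.4.4 Cor. 2.4.26 (p. 124)] -/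
theorem Polarization.nonempty_centralizer_baseChange_algEquiv_pi_minimal_stable (ψ : Polarization H) :
    Nonempty (Subalgebra.centralizer K ((fun a : Module.End ℚ V => a.baseChange K) '' (H.endAlg : Set (Module.End ℚ V))) ≃ₐ[K]
      Π S : {S : SubHodgeStructure H // (∀ a ∈ H.endAlg, ∀ v ∈ S.toSubmodule, a v ∈ S.toSubmodule) ∧ S.toSubmodule ≠ ⊥ ∧
        ∀ S' : SubHodgeStructure H, (∀ a ∈ H.endAlg, ∀ v ∈ S'.toSubmodule, a v ∈ S'.toSubmodule) →
          S'.toSubmodule ≤ S.toSubmodule → S'.toSubmodule = ⊥ ∨ S'.toSubmodule = S.toSubmodule},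
        Subalgebra.centralizer K ((fun a : Module.End ℚ (S : SubHodgeStructure H).toSubmodule => a.baseChange K) ''
          ((S : SubHodgeStructure H).toHodgeStructure.endAlg : Set (Module.End ℚ (S : SubHodgeStructure H).toSubmodule)))) := by
  haveI : Fintype {S : SubHodgeStructure H // (∀ a ∈ H.endAlg, ∀ v ∈ S.toSubmodule, a v ∈ S.toSubmodule) ∧ S.toSubmodule ≠ ⊥ ∧
      ∀ S' : SubHodgeStructure H, (∀ a ∈ H.endAlg, ∀ v ∈ S'.toSubmodule, a v ∈ S'.toSubmodule) →
        S'.toSubmodule ≤ S.toSubmodule → S'.toSubmodule = ⊥ ∨ S'.toSubmodule = S.toSubmodule} :=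
    ψ.finite_setOf_minimal_stable.fintype
  exact nonempty_centralizer_baseChange_algEquiv_pi_of_hom_orthogonal K
    (Subtype.val : {S : SubHodgeStructure H // (∀ a ∈ H.endAlg, ∀ v ∈ S.toSubmodule, a v ∈ S.toSubmodule) ∧ S.toSubmodule ≠ ⊥ ∧
      ∀ S' : SubHodgeStructure H, (∀ a ∈ H.endAlg, ∀ v ∈ S'.toSubmodule, a v ∈ S'.toSubmodule) →
        S'.toSubmodule ≤ S.toSubmodule → S'.toSubmodule = ⊥ ∨ S'.toSubmodule = S.toSubmodule} → SubHodgeStructure H)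
    ψ.isInternal_minimal_stable
    fun S S' hne f => ψ.hom_eq_zero_of_minimal_stable_of_ne S.2 S'.2 (fun h => hne (Subtype.ext h)) f

end Blocks

/-! ## §3 Prop. 1.1 on `K`-points over the representatives of the isotypy classes -/

section IsotypicInternal

variable {V' : Type u} [AddCommGroup V'] [Module ℚ V'] [Module.Finite ℚ V'] {H' : HodgeStructure V' n}
  {W₀ : Type u} [AddCommGroup W₀] [Module ℚ W₀] [Module.Finite ℚ W₀] {H₀ : HodgeStructure W₀ n}
  {ι : Type} [Fintype ι] [DecidableEq ι] (T : ι → SubHodgeStructure H')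
  (hT : DirectSum.IsInternal fun i => (T i).toSubmodule)
  (r : ∀ i, Hom H₀ (T i).toHodgeStructure) (hr : ∀ i, Function.Bijective (r i).toLinearMap)

include hT hr

/-- **«the diagonal action of `C(A)` on `rV(A)` identifies `C(A)` with `C(A^r)`», on `K`-points and internally: `C(H')(K) ≃ₐ[K]
C(H₀)(K)`** for an internal direct sum `V' = ⊕ᵢ Tᵢ` (`ι ≠ ∅`) of sub-Hodge structures all isomorphic to `H₀` (transport along
`H₀^{⊕ι} ⥲ H'`, then p34's diagonal). [cite: Milne1999LefschetzClasses, §1 p. 643 L12–L14 and Remark 1.6 (p. 644)] -/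
theorem nonempty_centralizer_baseChange_algEquiv_of_isInternal_of_forall_bijective [Nonempty ι] :
    Nonempty (Subalgebra.centralizer K ((fun a : Module.End ℚ V' => a.baseChange K) '' (H'.endAlg : Set (Module.End ℚ V'))) ≃ₐ[K]
      Subalgebra.centralizer K ((fun a : Module.End ℚ W₀ => a.baseChange K) '' (H₀.endAlg : Set (Module.End ℚ W₀)))) := by
  obtain ⟨e, -⟩ := exists_centralizer_baseChange_algEquiv_of_hom_bijective K _
    (bijective_piDesc_subtypeHom_comp_toLinearMap T hT r hr)
  exact ⟨e.symm.trans (centralizerBaseChangePiConstAlgEquiv K (ι := ι) H₀).symm⟩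

end IsotypicInternal

section Labelled

variable {V : Type u} [AddCommGroup V] [Module ℚ V] [Module.Finite ℚ V] {H : HodgeStructure V n}
  {ι : Type*} [Fintype ι] [DecidableEq ι] (T : ι → SubHodgeStructure H)
  (hT : DirectSum.IsInternal fun i => (T i).toSubmodule) {κ : Finset ι} {c : ι → κ}
  (hc : ∀ i, ∃ g : Hom (T i).toHodgeStructure (T (c i)).toHodgeStructure, Function.Bijective g.toLinearMap)
  (hκ : ∀ k k' : κ, (∃ g : Hom (T k).toHodgeStructure (T k').toHodgeStructure,
    Function.Bijective g.toLinearMap) → k = k')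

include hT hc hκ

/-- **`C(W_k)(K) ≃ₐ[K] C(T_k)(K)` for every isotypic block `W_k = ⨆_{c i = k} Tᵢ`** of a labelled irreducible decomposition (§3
after re-indexing by `Fin m`). [cite: Milne1999LefschetzClasses, §1 p. 643 L12–L14, Prop. 1.1 and Remark 1.6] -/
theorem nonempty_centralizer_baseChange_iSup'_fiber_algEquiv (k : κ) :
    Nonempty (Subalgebra.centralizer K
        ((fun a : Module.End ℚ (SubHodgeStructure.iSup' fun x : {i // c i = k} => T x.1).toSubmodule => a.baseChange K) ''
          ((SubHodgeStructure.iSup' fun x : {i // c i = k} => T x.1).toHodgeStructure.endAlg :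
            Set (Module.End ℚ (SubHodgeStructure.iSup' fun x : {i // c i = k} => T x.1).toSubmodule))) ≃ₐ[K]
      Subalgebra.centralizer K ((fun a : Module.End ℚ (T k).toSubmodule => a.baseChange K) ''
        ((T k).toHodgeStructure.endAlg : Set (Module.End ℚ (T k).toSubmodule)))) := by
  classical
  choose r hr using exists_hom_comapSubtype_bijective T hc k
  let eι := (Fintype.equivFin {i // c i = k}).symm
  haveI : Nonempty (Fin (Fintype.card {i // c i = k})) := ⟨Fintype.equivFin _ ⟨k, apply_coe_eq T hc hκ k⟩⟩
  exact nonempty_centralizer_baseChange_algEquiv_of_isInternal_of_forall_bijective K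
    (fun j => (SubHodgeStructure.iSup' fun x : {i // c i = k} => T x.1).comapSubtype (T (eι j).1))
    (isInternal_comp_equiv''' (isInternal_comapSubtype_iSup'_fiber T hT c k) eι) (fun j => r (eι j))
    fun j => hr (eι j)

/-- **MILNE'S PROPOSITION 1.1 ON `K`-POINTS over the representatives: `C(H)(K) ≃ₐ[K] Π_k C(T_k)(K)`** for every field `K ⊇ ℚ`
and ANY isotypically-labelled irreducible decomposition of a finite-dimensional `ℚ`-Hodge structure (the Hom-orthogonal isotypic
blocks `W_k`, §2, then `C(W_k)(K) ≃ₐ C(T_k)(K)` block by block). [cite: Milne1999LefschetzClasses, §1 Prop. 1.1 (p. 643) and Remark 1.6 (p. 644)] -/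
theorem nonempty_centralizer_baseChange_algEquiv_pi_of_labelling (hirr : ∀ i, (T i).toHodgeStructure.IsIrreducible) :
    Nonempty (Subalgebra.centralizer K ((fun a : Module.End ℚ V => a.baseChange K) '' (H.endAlg : Set (Module.End ℚ V))) ≃ₐ[K]
      Π k : κ, Subalgebra.centralizer K ((fun a : Module.End ℚ (T k).toSubmodule => a.baseChange K) ''
        ((T k).toHodgeStructure.endAlg : Set (Module.End ℚ (T k).toSubmodule)))) := by
  classical
  obtain ⟨e⟩ := nonempty_centralizer_baseChange_algEquiv_pi_of_hom_orthogonal K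
    (fun k : κ => SubHodgeStructure.iSup' fun x : {i // c i = k} => T x.1) (isInternal_iSup'_fiber T hT c)
    fun k l hkl f => hom_iSup'_fiber_eq_zero T hT hc hκ hirr hkl f
  exact ⟨e.trans (AlgEquiv.piCongrRight fun k =>
    Classical.choice (nonempty_centralizer_baseChange_iSup'_fiber_algEquiv K T hT hc hκ k))⟩

end Labelled

/-! ## §4 The canonical block on `K`-points: `C(S)(K) ≃ₐ[K] C(U)(K)` -/

section Canonical

variable {V : Type u} [AddCommGroup V] [Module ℚ V] [Module.Finite ℚ V] {H : HodgeStructure V n}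

/-- **`C(S)(K) ≃ₐ[K] C(U)(K)` for a CANONICAL BLOCK** (`H` polarizable, `S` minimal non-zero `E_φ`-stable, `U ⊆ S` irreducible),
for every field `K ⊇ ℚ`. [cite: Milne1999LefschetzClasses, §1 p. 643 L12–L14, Prop. 1.1 and Remark 1.6]
[cite: GreenGriffithsKerr2012, §V.B «Basic facts» (third bullet) (p. 159)] -/
theorem nonempty_centralizer_baseChange_algEquiv_of_minimal_stable (hH : H.IsPolarizable) {S U : SubHodgeStructure H}
    (hS : (∀ a ∈ H.endAlg, ∀ v ∈ S.toSubmodule, a v ∈ S.toSubmodule) ∧ S.toSubmodule ≠ ⊥ ∧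
      ∀ S' : SubHodgeStructure H, (∀ a ∈ H.endAlg, ∀ v ∈ S'.toSubmodule, a v ∈ S'.toSubmodule) →
        S'.toSubmodule ≤ S.toSubmodule → S'.toSubmodule = ⊥ ∨ S'.toSubmodule = S.toSubmodule)
    (hU : U.toHodgeStructure.IsIrreducible) (hUS : U.toSubmodule ≤ S.toSubmodule) :
    Nonempty (Subalgebra.centralizer K ((fun a : Module.End ℚ S.toSubmodule => a.baseChange K) ''
        (S.toHodgeStructure.endAlg : Set (Module.End ℚ S.toSubmodule))) ≃ₐ[K]
      Subalgebra.centralizer K ((fun a : Module.End ℚ U.toSubmodule => a.baseChange K) ''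
        (U.toHodgeStructure.endAlg : Set (Module.End ℚ U.toSubmodule)))) := by
  classical
  obtain ⟨s, _, κ, c, hint, hirr, hc, hκ⟩ := exists_isInternal_isIrreducible_labelling H hH
  obtain ⟨k, hk, -⟩ := existsUnique_iSup'_fiber_eq_of_minimal_stable (fun x : s => (x : SubHodgeStructure H)) hint hc hκ
    (fun x => hirr x x.2) hS
  subst hk
  obtain ⟨e₁⟩ := nonempty_centralizer_baseChange_iSup'_fiber_algEquiv K (fun x : s => (x : SubHodgeStructure H)) hint hc hκ k
  have hTk : ((k : s) : SubHodgeStructure H).toSubmodule ≤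
      (SubHodgeStructure.iSup' fun x : {i : s // c i = k} => ((x.1 : s) : SubHodgeStructure H)).toSubmodule := by
    rw [SubHodgeStructure.iSup'_toSubmodule]
    exact le_iSup (fun x : {i : s // c i = k} => ((x.1 : s) : SubHodgeStructure H).toSubmodule)
      ⟨k, apply_coe_eq (fun x : s => (x : SubHodgeStructure H)) hc hκ k⟩
  obtain ⟨g, hg⟩ := (exists_hom_bijective_iff_eq_of_minimal_stable hH hS hS (hirr (k : s) (k : s).2) hU hTk hUS).2 rfl
  obtain ⟨e₂, -⟩ := exists_centralizer_baseChange_algEquiv_of_hom_bijective K g hg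
  exact ⟨e₁.trans e₂⟩

end Canonical

end HodgeStructure

end Literature.AlgebraicGeometry.Motives
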